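import Mathlib

/-!
# The Milnor square of an Eisenstein annihilator (algebraic core of THEOREM M, s42)

In the solo-informed cell programme (FINDING_M, s42) the flat level-one pseudodeformation
ring `R = R_F^𝒞` at a cyclic `p = 7` cell carries an *Eisenstein annihilator*: an element
`z` with `z ≡ c (mod I)` (`c = 7^e`, `I` the reducibility = Eisenstein ideal) and `z · I = 0`.
The purely algebraic consequences used there are collected here, for an arbitrary
commutative ring `R`:

* `sq_eq_mul_of_sub_mem` : `z - c ∈ I` and `z · I = 0` give `z² = c z`;
* `mul_eq_zero_of_mul_mem` : if moreover `c` is a non-zero-divisor on `zR`, then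
  `zR ∩ I = 0` (`span_singleton_inf_eq_bot`), so `R → R/(z) × R/I` is injective
  (`eq_of_mk_eq_of_mk_eq`);
* `exists_lift_of_mk_sup_eq` / `mk_inf_eq_of_mk_eq` : for any two ideals `I, J` the ring
  `R/(I ∩ J)` is the fibre product of `R/I` and `R/J` over `R/(I + J)` (Milnor square);
* `exists_ne_zero_forall_mul_eq_zero` : a non-zero element killed by a power of an ideal `M`
  produces a non-zero element killed by `M` itself ("a finite non-zero ideal forces depth
  zero", used for COROLLARY T′(ii): such a ring is not Cohen–Macaulay).

No number theory is formalised here.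
-/

namespace Summit.Langlands.Langlands.Theorems

variable {R : Type*} [CommRing R]

/-- If `z - c ∈ I` and `z` annihilates `I`, then `z² = c·z`. -/
theorem sq_eq_mul_of_sub_mem {z c : R} {I : Ideal R}
    (hI : ∀ i ∈ I, z * i = 0) (hzc : z - c ∈ I) : z * z = c * z := by
  have h := hI _ hzc
  linear_combination h

/-- If `z² = c z`, `z` annihilates `I`, and `c` is a non-zero-divisor on the multiples of `z`,
then every multiple of `z` lying in `I` vanishes. -/
theorem mul_eq_zero_of_mul_mem {z c : R} (hz : z * z = c * z) {I : Ideal R}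
    (hI : ∀ i ∈ I, z * i = 0) (hc : ∀ r : R, c * (z * r) = 0 → z * r = 0)
    {r : R} (hr : z * r ∈ I) : z * r = 0 := by
  have h1 : z * (z * r) = 0 := hI _ hr
  have h2 : c * (z * r) = 0 := by
    calc c * (z * r) = (c * z) * r := by ring
      _ = (z * z) * r := by rw [hz]
      _ = z * (z * r) := by ring
      _ = 0 := h1
  exact hc r h2

/-- Under the same hypotheses, `zR ∩ I = 0`. -/
theorem span_singleton_inf_eq_bot {z c : R} (hz : z * z = c * z) {I : Ideal R}
    (hI : ∀ i ∈ I, z * i = 0) (hc : ∀ r : R, c * (z * r) = 0 → z * r = 0) :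
    Ideal.span {z} ⊓ I = ⊥ := by
  rw [eq_bot_iff]
  intro x hx
  obtain ⟨hx1, hx2⟩ := hx
  obtain ⟨r, rfl⟩ := Ideal.mem_span_singleton'.mp hx1
  have hr : z * r ∈ I := by rw [mul_comm]; exact hx2
  have h0 : z * r = 0 := mul_eq_zero_of_mul_mem hz hI hc hr
  rw [Ideal.mem_bot, mul_comm]
  exact h0

/-- Under the same hypotheses the map `R → R/(z) × R/I` is injective. -/
theorem eq_of_mk_eq_of_mk_eq {z c : R} (hz : z * z = c * z) {I : Ideal R}
    (hI : ∀ i ∈ I, z * i = 0) (hc : ∀ r : R, c * (z * r) = 0 → z * r = 0)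
    {a b : R} (h1 : Ideal.Quotient.mk (Ideal.span {z}) a = Ideal.Quotient.mk (Ideal.span {z}) b)
    (h2 : Ideal.Quotient.mk I a = Ideal.Quotient.mk I b) : a = b := by
  rw [Ideal.Quotient.eq] at h1 h2
  have hmem : a - b ∈ Ideal.span {z} ⊓ I := ⟨h1, h2⟩
  rw [span_singleton_inf_eq_bot hz hI hc, Ideal.mem_bot] at hmem
  exact sub_eq_zero.mp hmem

/-- Milnor square, surjectivity half: a pair of classes in `R/I × R/J` that agree in
`R/(I + J)` comes from a single element of `R`. -/
theorem exists_lift_of_mk_sup_eq (I J : Ideal R) {a b : R}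
    (h : Ideal.Quotient.mk (I ⊔ J) a = Ideal.Quotient.mk (I ⊔ J) b) :
    ∃ t : R, Ideal.Quotient.mk I t = Ideal.Quotient.mk I a ∧
      Ideal.Quotient.mk J t = Ideal.Quotient.mk J b := by
  rw [Ideal.Quotient.eq] at h
  obtain ⟨i, hi, j, hj, hij⟩ := Submodule.mem_sup.mp h
  refine ⟨a - i, ?_, ?_⟩
  · rw [Ideal.Quotient.eq]
    have : a - i - a = -i := by ring
    rw [this]
    exact I.neg_mem hi
  · rw [Ideal.Quotient.eq]
    have : a - i - b = j := by linear_combination -hij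
    rw [this]
    exact hj

/-- Milnor square, injectivity half: classes agreeing in `R/I` and in `R/J` agree in
`R/(I ∩ J)`. -/
theorem mk_inf_eq_of_mk_eq (I J : Ideal R) {a b : R}
    (h1 : Ideal.Quotient.mk I a = Ideal.Quotient.mk I b)
    (h2 : Ideal.Quotient.mk J a = Ideal.Quotient.mk J b) :
    Ideal.Quotient.mk (I ⊓ J) a = Ideal.Quotient.mk (I ⊓ J) b := by
  rw [Ideal.Quotient.eq] at h1 h2 ⊢
  exact ⟨h1, h2⟩

/-- Depth zero from a finite non-zero ideal: if `y ≠ 0` is killed by some power `M ^ k` of an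
ideal `M`, then some non-zero element of `R` is killed by `M` itself (so, when `M` is the
maximal ideal of a local ring, `M` consists of zero-divisors and the ring has depth `0`). -/
theorem exists_ne_zero_forall_mul_eq_zero (M : Ideal R) {y : R} (hy : y ≠ 0)
    (hk : ∃ k : ℕ, ∀ m ∈ M ^ k, m * y = 0) :
    ∃ w : R, w ≠ 0 ∧ ∀ m ∈ M, m * w = 0 := by
  obtain ⟨k, hk⟩ := hk
  induction k with
  | zero =>
    exfalso
    apply hy
    have h1 : (1 : R) ∈ M ^ 0 := by
      rw [pow_zero, Ideal.one_eq_top]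
      exact Submodule.mem_top
    have := hk 1 h1
    simpa using this
  | succ n ih =>
    by_cases h : ∀ m ∈ M ^ n, m * y = 0
    · exact ih h
    · push Not at h
      obtain ⟨m', hm', hne⟩ := h
      refine ⟨m' * y, hne, fun m hm => ?_⟩
      have hmm : m * m' ∈ M ^ (n + 1) := by
        rw [pow_succ']
        exact Ideal.mul_mem_mul hm hm'
      calc m * (m' * y) = (m * m') * y := by ring
        _ = 0 := hk _ hmm

end Summit.Langlands.Langlands.Theorems
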